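import Summits.RiemannHypothesis.RiemannHypothesis.Theorems.SoloInformedGroundStateDecay
import Summits.RiemannHypothesis.RiemannHypothesis.Theorems.SoloInformedGroundStateWindowQuant
import Summits.RiemannHypothesis.RiemannHypothesis.Theorems.SoloInformedGroundStatePoissonQuant
import Summits.RiemannHypothesis.RiemannHypothesis.Theorems.SoloInformedGroundStateFamilyFourier

/-!
# Ground-state endgame, XVI: doubly-exponential thinness of the Weil ground state

Solo programme `solo-RiemannHypothesis-informed`, session 2, claim C28 — the sharpening of C17
(`weilGroundEnergy_superpoly`, part X) from `ε(a) = O_N(e^{-Na})` to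

  `ε(a) ≤ C exp(-c e^{2a})`  for all `a ≥ 1`, with absolute `c > 0`, `C`,

i.e. `ε(a) = O(exp(-c Λ²))` in the natural scale `Λ = e^{a}` of the E-map — the shape of the lower
envelope in Connes's law (up to the constant in the exponent), proved here UNCONDITIONALLY as an
upper bound. Mechanism: run the C17 construction with the `λ`-dependent seed `h_{M(λ)}` of parts
XIII–XIV, `M(λ) + 1 ≍ λ²`: its Fourier transform is `≤ A₀ 2^{-(M+1)} ξ⁻²` beyond `ξ ≍ M + 1 ≍ λ²`,
which is exactly the frequency range the leak window `u ≤ 2/(λ+1)` sees after Poisson summation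
(part XII), so the window test is `O(2^{-M} λ^{-2})` at every zero while `|ĝ_λ(2)| ≍ λ²` uniformly.
With `a = log(λ+1) + 1` this gives `ε(a) ≤ C 2^{-cλ²} = C exp(-c' e^{2a})`.
-/

noncomputable section
open Filter Set Topology MeasureTheory
open scoped FourierTransform
open Literature.NumberTheory.LFunctions Literature.NumberTheory.LFunctions.WeilContinuous

namespace Summit.RiemannHypothesis.RiemannHypothesis.Theorems

/-! ## The constants of the family and the choice `M(λ)` -/

/-- The frequency threshold `X₀` of the family (part XIV). -/
def fdX : ℝ := Classical.choose hFam_fourier_decay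

/-- `X₀ > 0`. -/
theorem fdX_pos : 0 < fdX := (Classical.choose_spec hFam_fourier_decay).1

/-- The decay of `𝓕 h_M` beyond `X₀ (M+1)`. -/
theorem fdX_spec : ∃ A₀ : ℝ, 0 ≤ A₀ ∧ ∀ M : ℕ, ∀ ξ : ℝ, fdX * (M + 1) ≤ ξ →
    ‖(𝓕 (hFam M) : SchwartzMap ℝ ℂ) ξ‖ ≤ A₀ * (1 / 2) ^ (M + 1) * (ξ ^ 2)⁻¹ :=
  (Classical.choose_spec hFam_fourier_decay).2

/-- `M(λ) = ⌊λ²/(4X₀)⌋`. -/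
def decayM (lam : ℝ) : ℕ := ⌊lam ^ 2 / (4 * fdX)⌋₊

/-- `X₀ (M(λ)+1) ≤ λ²/2` once `λ² ≥ 4 X₀`. -/
theorem fdX_mul_decayM_le {lam : ℝ} (hlam : 4 * fdX ≤ lam ^ 2) :
    fdX * (decayM lam + 1) ≤ lam ^ 2 / 2 := by
  have hX := fdX_pos
  have h1 : (decayM lam : ℝ) ≤ lam ^ 2 / (4 * fdX) := Nat.floor_le (by positivity)
  have h2 : (1 : ℝ) ≤ lam ^ 2 / (4 * fdX) := by rw [le_div_iff₀ (by positivity)]; linarith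
  calc fdX * (decayM lam + 1) ≤ fdX * (lam ^ 2 / (4 * fdX) + lam ^ 2 / (4 * fdX)) := by gcongr
    _ = lam ^ 2 / 2 := by field_simp; ring

/-- The gain: `2^{-(M(λ)+1)} ≤ exp(-(log 2/(4X₀)) λ²)`. -/
theorem half_pow_decayM_le (lam : ℝ) :
    (1 / 2 : ℝ) ^ (decayM lam + 1) ≤ Real.exp (-(Real.log 2 / (4 * fdX)) * lam ^ 2) := by
  have hX := fdX_pos
  have hM : lam ^ 2 / (4 * fdX) < (decayM lam : ℝ) + 1 := Nat.lt_floor_add_one _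
  rw [show (1 / 2 : ℝ) ^ (decayM lam + 1) = Real.exp (-(((decayM lam + 1 : ℕ) : ℝ) * Real.log 2)) by
    rw [Real.exp_neg, Real.exp_nat_mul, Real.exp_log two_pos, one_div, inv_pow]]
  refine Real.exp_le_exp.2 ?_
  have hlog : 0 < Real.log 2 := Real.log_pos one_lt_two
  push_cast
  have : Real.log 2 / (4 * fdX) * lam ^ 2 = lam ^ 2 / (4 * fdX) * Real.log 2 := by ring
  rw [neg_mul, this]
  nlinarith

/-- `2^{-(M+1)} ≤ 1`. -/
theorem half_pow_le_one (M : ℕ) : (1 / 2 : ℝ) ^ (M + 1) ≤ 1 := pow_le_one₀ (by norm_num) (by norm_num)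

/-! ## The leak-window bound for the family -/

/-- **LINEAR LEAK-WINDOW BOUND WITH GAIN**: `‖S_λ(u)‖ ≤ A₁ 2^{-(M(λ)+1)} u/λ` for
`0 < u ≤ 2/(λ+1)`, `λ ≥ 1`, `λ² ≥ 4X₀`, with the seed `h_{M(λ)}`. -/
theorem norm_eMapFn_hFam_le : ∃ A₁ : ℝ, 0 ≤ A₁ ∧ ∀ lam : ℝ, 1 ≤ lam → 4 * fdX ≤ lam ^ 2 →
    ∀ u : ℝ, 0 < u → u ≤ 2 / (lam + 1) →
      ‖eMapFn (hFam (decayM lam)) lam u‖ ≤ A₁ * (1 / 2) ^ (decayM lam + 1) * (lam⁻¹ * u) := by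
  obtain ⟨A₀, hA₀, hF⟩ := fdX_spec
  refine ⟨3 * A₀, by positivity, fun lam hlam hlam2 u hu huU => ?_⟩
  have hX := fdX_pos
  have hlam0 : 0 < lam := by linarith
  set M := decayM lam with hMdef
  have hXM : 0 < fdX * (M + 1) := by positivity
  have hux : fdX * (M + 1) * u ≤ lam := by
    have h1 := fdX_mul_decayM_le hlam2
    rw [← hMdef] at h1
    have h2 : fdX * (M + 1) * u ≤ lam ^ 2 / 2 * (2 / (lam + 1)) :=
      mul_le_mul h1 huU hu.le (by positivity)
    have h3 : lam ^ 2 / 2 * (2 / (lam + 1)) ≤ lam := by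
      rw [show lam ^ 2 / 2 * (2 / (lam + 1)) = lam ^ 2 / (lam + 1) by field_simp,
        div_le_iff₀ (by linarith)]
      nlinarith
    linarith
  have key := norm_eMapFn_le_of_fourier_decay (hFam M) (hFam_even M) (hFam_zero M) (integral_hFam M)
    (A := A₀ * (1 / 2) ^ (M + 1)) (X := fdX * (M + 1)) (by positivity) hXM
    (fun ξ hξ => hF M ξ hξ) hlam0 hu hux
  calc ‖eMapFn (hFam M) lam u‖ ≤ 3 * (A₀ * (1 / 2) ^ (M + 1)) * (lam⁻¹ * u) := key
    _ = 3 * A₀ * (1 / 2) ^ (M + 1) * (lam⁻¹ * u) := by ring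

/-! ## The test functions -/

/-- `k_λ = g_λ ⋆ m` with the seed `h_{M(λ)}`. -/
def decayTest2 (lam : ℝ) : ℝ → ℂ := weilConv (winTest (hFam (decayM lam)) lam) (moll 0)

/-- `k_λ` is a Weil test function. -/
theorem isWeilTest_decayTest2 {lam : ℝ} (hlam : 0 < lam) : IsWeilTest (decayTest2 lam) :=
  isWeilTest_weilConv_moll (continuous_winTest (hFam (decayM lam)) hlam)
    (hasCompactSupport_winTest (hFam (decayM lam)) (hFam_eq_zero_of_one_lt (decayM lam)) hlam) 0

/-- `k_λ` vanishes for `|x| > a(λ)`. -/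
theorem decayTest2_eq_zero {lam : ℝ} (hlam : 0 < lam) {x : ℝ} (hx : decayRadius lam < |x|) :
    decayTest2 lam x = 0 :=
  weilConv_moll_eq_zero
    (fun _ hu => winTest_eq_zero (hFam (decayM lam)) (hFam_eq_zero_of_one_lt (decayM lam)) hlam hu) hx 0

/-- Support of `k_λ`. -/
theorem tsupport_decayTest2 {lam : ℝ} (hlam : 0 < lam) :
    tsupport (decayTest2 lam) ⊆ Icc (-decayRadius lam) (decayRadius lam) := by
  refine closure_minimal (fun t ht => ?_) isClosed_Icc
  by_contra habs
  refine ht (decayTest2_eq_zero hlam ?_)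
  by_contra hle
  push Not at hle
  exact habs ⟨by linarith [neg_abs_le t], by linarith [le_abs_self t]⟩

/-- `k̂_λ = ĝ_λ · m̂`. -/
theorem weilMellin_decayTest2 {lam : ℝ} (hlam : 0 < lam) (s : ℂ) :
    weilMellin (decayTest2 lam) s
      = weilMellin (winTest (hFam (decayM lam)) lam) s * weilMellin (moll 0) s :=
  weilMellin_weilConv_moll (continuous_winTest (hFam (decayM lam)) hlam)
    (hasCompactSupport_winTest (hFam (decayM lam)) (hFam_eq_zero_of_one_lt (decayM lam)) hlam) 0 s

/-! ## Zero side -/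

/-- **ZERO SIDE.** `Re W(k_λ ⋆ k̃_λ) ≤ C 4^{-(M(λ)+1)}` for `λ ≥ λ₁`. -/
theorem re_weilQuadratic_decayTest2_le :
    ∃ C lam₁ : ℝ, 0 ≤ C ∧ 1 ≤ lam₁ ∧ ∀ lam : ℝ, lam₁ ≤ lam →
      (weilQuadratic (decayTest2 lam)).re ≤ C * ((1 / 2 : ℝ) ^ (decayM lam + 1)) ^ 2 := by
  obtain ⟨A₁, hA₁, hE⟩ := norm_eMapFn_hFam_le
  set D : ℝ := weilDecayConst (moll 0) with hD
  set W : ℝ := ∑' ρ : ZetaZeros.riemannZetaNontrivialZeros, weilZeroWeight (ρ : ℂ) with hW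
  have hD0 : 0 ≤ D := weilDecayConst_nonneg _
  have hW0 : 0 ≤ W := tsum_weilZeroWeight_nonneg
  refine ⟨(2 * A₁ * D) ^ 2 * W, max 1 (4 * fdX), by positivity, le_max_left _ _, fun lam hlam => ?_⟩
  have hlam1 : 1 ≤ lam := (le_max_left _ _).trans hlam
  have hlam0 : 0 < lam := by linarith
  have hlam2 : 4 * fdX ≤ lam ^ 2 := by
    have := (le_max_right _ _).trans hlam
    nlinarith
  set M := decayM lam with hMdef
  set q : ℝ := (1 / 2 : ℝ) ^ (M + 1) with hq
  have hq0 : 0 ≤ q := by positivity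
  have hEq : ∀ u : ℝ, 0 < u → u ≤ 2 / (lam + 1) →
      ‖eMapFn (hFam M) lam u‖ ≤ A₁ * q * (lam⁻¹ * u) := fun u hu huU => hE lam hlam1 hlam2 u hu huU
  set A : ℝ := (2 * A₁ * q * D) ^ 2 with hA
  have hzero : ∀ ρ ∈ ZetaZeros.riemannZetaNontrivialZeros,
      ‖weilMellin (decayTest2 lam) ρ‖ ^ 2 ≤ A / (1 + ρ.im ^ 2) ^ 2 := by
    intro ρ hρ
    obtain ⟨-, hre, hre1⟩ := mem_riemannZetaNontrivialZeros_iff_holds.1 hρ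
    have h1 : ‖weilMellin (winTest (hFam M) lam) ρ‖ ≤ 2 * A₁ * q := by
      have := norm_weilMellin_winTest_le_of_bound (hFam M) (hFam_even M) (hFam_zero M)
        (integral_hFam M) (hFam_eq_zero_of_one_lt M) (by positivity) hlam1 hEq hρ
      calc ‖weilMellin (winTest (hFam M) lam) ρ‖ ≤ 2 * (A₁ * q) / lam ^ 2 := this
        _ ≤ 2 * (A₁ * q) / 1 := div_le_div_of_nonneg_left (by positivity) one_pos (by nlinarith)
        _ = 2 * A₁ * q := by ring
    have h2 : ‖weilMellin (moll 0) ρ‖ ≤ D / (1 + ρ.im ^ 2) :=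
      norm_weilMellin_le (isWeilTest_moll 0) hre.le hre1.le
    have hpos : 0 < 1 + ρ.im ^ 2 := by positivity
    have h3 : ‖weilMellin (decayTest2 lam) ρ‖ ≤ 2 * A₁ * q * D / (1 + ρ.im ^ 2) := by
      rw [weilMellin_decayTest2 hlam0, norm_mul, mul_div_assoc]
      exact mul_le_mul h1 h2 (norm_nonneg _) (by positivity)
    have h4 : 0 ≤ 2 * A₁ * q * D / (1 + ρ.im ^ 2) := by positivity
    calc ‖weilMellin (decayTest2 lam) ρ‖ ^ 2 ≤ (2 * A₁ * q * D / (1 + ρ.im ^ 2)) ^ 2 :=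
          pow_le_pow_left₀ (norm_nonneg _) h3 2
      _ = A / (1 + ρ.im ^ 2) ^ 2 := by rw [hA, div_pow]
  have hsum := zeroSum_le_of_norm_sq_le (g := decayTest2 lam) (A := A) (by positivity) hzero
  have := re_weilQuadratic_le_of_zeroSum_le (isWeilTest_decayTest2 hlam0) hsum
  calc (weilQuadratic (decayTest2 lam)).re ≤ A * W := this
    _ = (2 * A₁ * D) ^ 2 * W * q ^ 2 := by rw [hA]; ring

/-! ## Norm side -/

/-- **NORM SIDE, I.** `|k̂_λ(2)| ≥ c λ²` for `λ ≥ λ₀`. -/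
theorem norm_weilMellin_decayTest2_two_ge :
    ∃ c lam₀ : ℝ, 0 < c ∧ 1 ≤ lam₀ ∧ ∀ lam : ℝ, lam₀ ≤ lam →
      c * lam ^ 2 ≤ ‖weilMellin (decayTest2 lam) 2‖ := by
  obtain ⟨A₁, hA₁, hE⟩ := norm_eMapFn_hFam_le
  set μ₀ : ℝ := 3 / 64 * ∫ x, (seedBump : ℝ → ℝ) x with hμ₀
  have hμ₀0 : 0 < μ₀ := by rw [hμ₀]; exact mul_pos (by norm_num) integral_seedBump_pos
  set c₀ : ℝ := Real.pi ^ 2 / 6 * μ₀ with hc₀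
  have hc₀0 : 0 < c₀ := by positivity
  set C₂ : ℝ := 2 * A₁ with hC₂
  refine ⟨c₀ / 2 * Real.exp (-(3 / 2 : ℝ)), max (max 1 (4 * fdX)) (2 * C₂ / c₀ + 1), by positivity,
    (le_max_left _ _).trans (le_max_left _ _), fun lam hlam => ?_⟩
  have hlam1 : 1 ≤ lam := ((le_max_left _ _).trans (le_max_left _ _)).trans hlam
  have hlam0 : 0 < lam := by linarith
  have hlam2 : 4 * fdX ≤ lam ^ 2 := by
    have := ((le_max_right _ _).trans (le_max_left _ _)).trans hlam
    nlinarith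
  have hlamC : 2 * C₂ / c₀ ≤ lam := by linarith [(le_max_right _ _).trans hlam]
  set M := decayM lam with hMdef
  set q : ℝ := (1 / 2 : ℝ) ^ (M + 1) with hq
  have hq0 : 0 ≤ q := by positivity
  have hq1 : q ≤ 1 := half_pow_le_one M
  have hEq : ∀ u : ℝ, 0 < u → u ≤ 2 / (lam + 1) →
      ‖eMapFn (hFam M) lam u‖ ≤ A₁ * q * (lam⁻¹ * u) := fun u hu huU => hE lam hlam1 hlam2 u hu huU
  have hwin := norm_weilMellin_winTest_two_ge_of_bound (hFam M) (hFam_even M) (hFam_zero M)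
    (integral_hFam M) (hFam_eq_zero_of_one_lt M) (by positivity) hlam1 hEq
  -- the error term is at most `C₂`
  have herr : 2 * (A₁ * q) / lam ^ 2 ≤ C₂ := by
    calc 2 * (A₁ * q) / lam ^ 2 ≤ 2 * (A₁ * q) / 1 :=
          div_le_div_of_nonneg_left (by positivity) one_pos (by nlinarith)
      _ ≤ 2 * (A₁ * 1) / 1 := by gcongr
      _ = C₂ := by rw [hC₂]; ring
  -- the main term is at least `c₀ λ²`
  have hmain : c₀ * lam ^ 2 ≤ Real.pi ^ 2 / 6 * ‖mellin (fun x : ℝ => hFam M x) 2‖ * lam ^ 2 := by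
    have := norm_mellin_hFam_two_ge M
    rw [hc₀]
    have h' : Real.pi ^ 2 / 6 * μ₀ ≤ Real.pi ^ 2 / 6 * ‖mellin (fun x : ℝ => hFam M x) 2‖ :=
      mul_le_mul_of_nonneg_left this (by positivity)
    exact mul_le_mul_of_nonneg_right h' (by positivity)
  -- `C₂ ≤ (c₀/2) λ²`
  have hC : C₂ ≤ c₀ / 2 * lam ^ 2 := by
    have h1 : 2 * C₂ ≤ c₀ * lam := by
      have := (div_le_iff₀ hc₀0).1 hlamC
      linarith
    have h2 : c₀ * lam ≤ c₀ * lam ^ 2 := by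
      rw [sq]
      exact mul_le_mul_of_nonneg_left (le_mul_of_one_le_left hlam0.le hlam1) hc₀0.le
    linarith
  have hg : c₀ / 2 * lam ^ 2 ≤ ‖weilMellin (winTest (hFam M) lam) 2‖ := by linarith
  rw [weilMellin_decayTest2 hlam0, norm_mul]
  calc c₀ / 2 * Real.exp (-(3 / 2 : ℝ)) * lam ^ 2 = c₀ / 2 * lam ^ 2 * Real.exp (-(3 / 2 : ℝ)) := by ring
    _ ≤ ‖weilMellin (winTest (hFam M) lam) 2‖ * ‖weilMellin (moll 0) 2‖ :=
        mul_le_mul hg norm_weilMellin_moll_zero_two_ge (Real.exp_pos _).le (norm_nonneg _)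

/-- **NORM SIDE, II** (generic): `‖k‖₂² ≥ |k̂(2)|² e^{-3a}/(2a)` for a Weil test `k` supported in
`[-a, a]`. -/
theorem integral_norm_sq_ge_of_support {k : ℝ → ℂ} (hk : IsWeilTest k) {a : ℝ} (ha0 : 0 < a)
    (hsupp : tsupport k ⊆ Icc (-a) a) :
    ‖weilMellin k 2‖ ^ 2 * (Real.exp (-(3 * a)) / (2 * a)) ≤ ∫ t : ℝ, ‖k t‖ ^ 2 := by
  have h1 : ‖weilMellin k 2‖ ≤ Real.exp (a * |(2 : ℂ).re - 1 / 2|) * ∫ t, ‖k t‖ :=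
    norm_weilMellin_le_exp_mul_integral_norm hk.1.continuous hk.2 hsupp 2
  have h32 : |(2 : ℂ).re - 1 / 2| = 3 / 2 := by norm_num
  rw [h32] at h1
  have h2 : weilNorm1 k ^ 2 ≤ 2 * a * weilNorm2Sq k := weilNorm1_sq_le hk ha0 hsupp
  simp only [weilNorm1, weilNorm2Sq] at h2
  have hI0 : 0 ≤ ∫ t, ‖k t‖ := integral_nonneg fun t => norm_nonneg _
  have h3 : ‖weilMellin k 2‖ ^ 2 ≤ Real.exp (3 * a) * (2 * a * ∫ t : ℝ, ‖k t‖ ^ 2) := by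
    calc ‖weilMellin k 2‖ ^ 2 ≤ (Real.exp (a * (3 / 2)) * ∫ t, ‖k t‖) ^ 2 :=
          pow_le_pow_left₀ (norm_nonneg _) h1 2
      _ = Real.exp (3 * a) * (∫ t, ‖k t‖) ^ 2 := by
          rw [mul_pow, ← Real.exp_nat_mul]; ring_nf
      _ ≤ Real.exp (3 * a) * (2 * a * ∫ t : ℝ, ‖k t‖ ^ 2) :=
          mul_le_mul_of_nonneg_left h2 (Real.exp_pos _).le
  have hfac : 0 ≤ Real.exp (-(3 * a)) / (2 * a) := by positivity
  calc ‖weilMellin k 2‖ ^ 2 * (Real.exp (-(3 * a)) / (2 * a))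
      ≤ Real.exp (3 * a) * (2 * a * ∫ t : ℝ, ‖k t‖ ^ 2) * (Real.exp (-(3 * a)) / (2 * a)) :=
        mul_le_mul_of_nonneg_right h3 hfac
    _ = ∫ t : ℝ, ‖k t‖ ^ 2 := by
        rw [Real.exp_neg]
        field_simp

/-! ## Assembly -/

/-- **MAIN ESTIMATE IN `λ`.** `ε(a(λ)) ≤ C exp(-κ λ²)` for `λ ≥ λ₀`, `κ = log 2/(4X₀)`. -/
theorem weilGroundEnergy_decayRadius_le_exp :
    ∃ C lam₀ : ℝ, 0 ≤ C ∧ 1 ≤ lam₀ ∧ ∀ lam : ℝ, lam₀ ≤ lam →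
      weilGroundEnergy (decayRadius lam) ≤ C * Real.exp (-(Real.log 2 / (4 * fdX)) * lam ^ 2) := by
  obtain ⟨C, lam₁, hC0, hlam₁, hC⟩ := re_weilQuadratic_decayTest2_le
  obtain ⟨c, lam₀, hc, hlam₀, hcl⟩ := norm_weilMellin_decayTest2_two_ge
  refine ⟨C * (32 * Real.exp 3) / c ^ 2, max lam₀ lam₁, by positivity,
    hlam₀.trans (le_max_left _ _), fun lam hlam => ?_⟩
  have hl0 : lam₀ ≤ lam := (le_max_left _ _).trans hlam
  have hl1 : lam₁ ≤ lam := (le_max_right _ _).trans hlam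
  have hlam1 : 1 ≤ lam := hlam₀.trans hl0
  have hlam0 : 0 < lam := by linarith
  set a := decayRadius lam with ha
  have ha0 : 0 < a := decayRadius_pos hlam0
  set q : ℝ := (1 / 2 : ℝ) ^ (decayM lam + 1) with hq
  have hq0 : 0 ≤ q := by positivity
  have hq1 : q ≤ 1 := half_pow_le_one _
  set N2 : ℝ := ∫ t : ℝ, ‖decayTest2 lam t‖ ^ 2 with hN2
  have hk2 : c * lam ^ 2 ≤ ‖weilMellin (decayTest2 lam) 2‖ := hcl lam hl0
  have hlow : (c * lam ^ 2) ^ 2 * (Real.exp (-(3 * a)) / (2 * a)) ≤ N2 := by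
    calc (c * lam ^ 2) ^ 2 * (Real.exp (-(3 * a)) / (2 * a))
        ≤ ‖weilMellin (decayTest2 lam) 2‖ ^ 2 * (Real.exp (-(3 * a)) / (2 * a)) :=
          mul_le_mul_of_nonneg_right (pow_le_pow_left₀ (by positivity) hk2 2) (by positivity)
      _ ≤ N2 := integral_norm_sq_ge_of_support (isWeilTest_decayTest2 hlam0) ha0
          (tsupport_decayTest2 hlam0)
  have hlowpos : 0 < (c * lam ^ 2) ^ 2 * (Real.exp (-(3 * a)) / (2 * a)) := by positivity
  have hN2pos : 0 < N2 := hlowpos.trans_le hlow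
  have hR := weilGroundEnergy_le_div (isWeilTest_decayTest2 hlam0) (tsupport_decayTest2 hlam0) hN2pos
  have hQ : (weilQuadratic (decayTest2 lam)).re ≤ C * q ^ 2 := hC lam hl1
  have hnum : 0 ≤ C * q ^ 2 := by positivity
  have hae := decayRadius_mul_exp_le hlam1
  have hqexp : q ^ 2 ≤ Real.exp (-(Real.log 2 / (4 * fdX)) * lam ^ 2) := by
    calc q ^ 2 ≤ q ^ 1 := pow_le_pow_of_le_one hq0 hq1 one_le_two
      _ = q := pow_one q
      _ ≤ _ := half_pow_decayM_le lam
  calc weilGroundEnergy (decayRadius lam) ≤ (weilQuadratic (decayTest2 lam)).re / N2 := hR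
    _ ≤ C * q ^ 2 / N2 := div_le_div_of_nonneg_right hQ hN2pos.le
    _ ≤ C * q ^ 2 / ((c * lam ^ 2) ^ 2 * (Real.exp (-(3 * a)) / (2 * a))) :=
        div_le_div_of_nonneg_left hnum hlowpos hlow
    _ = C * q ^ 2 * (2 * a * Real.exp (3 * a)) / (c ^ 2 * lam ^ 4) := by
        rw [Real.exp_neg]
        field_simp
    _ ≤ C * q ^ 2 * (32 * Real.exp 3 * lam ^ 4) / (c ^ 2 * lam ^ 4) := by
        gcongr
    _ = C * (32 * Real.exp 3) / c ^ 2 * q ^ 2 := by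
        field_simp
    _ ≤ C * (32 * Real.exp 3) / c ^ 2 * Real.exp (-(Real.log 2 / (4 * fdX)) * lam ^ 2) :=
        mul_le_mul_of_nonneg_left hqexp (by positivity)

/-- **UNCONDITIONAL DOUBLY-EXPONENTIAL THINNESS OF THE WEIL GROUND STATE** (claim C28 of the solo
programme, sharpening C17 `weilGroundEnergy_superpoly`): there are absolute `c > 0` and `C` with

  `ε(a) ≤ C exp(-c e^{2a})`  for all `a ≥ 1`,

where `ε(a) = weilGroundEnergy a` is the infimum of `Re W(g ⋆ g̃)` over `L²`-normalised smooth `g`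
supported in `[-a, a]`. In the natural dilation scale `Λ = e^{a}` this is `exp(-c Λ²)` — the
Gaussian-in-`Λ` shape of Connes's law — and no hypothesis on the zeros is used. -/
theorem weilGroundEnergy_exp_exp_decay :
    ∃ c : ℝ, 0 < c ∧ ∃ C : ℝ, ∀ a : ℝ, 1 ≤ a →
      weilGroundEnergy a ≤ C * Real.exp (-c * Real.exp (2 * a)) := by
  obtain ⟨C, lam₀, hC0, hlam₀, hC⟩ := weilGroundEnergy_decayRadius_le_exp
  obtain ⟨B, hB0, hB⟩ := weilGroundEnergy_le_const
  set κ : ℝ := Real.log 2 / (4 * fdX) with hκ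
  have hκ0 : 0 < κ := div_pos (Real.log_pos one_lt_two) (by linarith [fdX_pos])
  -- `c = κ/(4e²)`: for large `a`, `λ = e^{a-1} - 1 ≥ e^{a-1}/2`, so `λ² ≥ e^{2a}/(4e²)`
  set c : ℝ := κ / (4 * Real.exp 2) with hc
  have hc0 : 0 < c := by positivity
  set a₁ : ℝ := max 2 (Real.log (lam₀ + 1) + 1) with ha₁
  refine ⟨c, hc0, max C (B * Real.exp (c * Real.exp (2 * a₁))), fun a ha => ?_⟩
  rcases le_or_gt a a₁ with hsmall | hlarge
  · -- small `a`: a priori bound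
    have hmono : Real.exp (-c * Real.exp (2 * a₁)) ≤ Real.exp (-c * Real.exp (2 * a)) := by
      refine Real.exp_le_exp.2 ?_
      have : Real.exp (2 * a) ≤ Real.exp (2 * a₁) := Real.exp_le_exp.2 (by linarith)
      nlinarith
    calc weilGroundEnergy a ≤ B := hB a ha
      _ = B * Real.exp (c * Real.exp (2 * a₁)) * Real.exp (-c * Real.exp (2 * a₁)) := by
          rw [mul_assoc, ← Real.exp_add, neg_mul, add_neg_cancel, Real.exp_zero, mul_one]
      _ ≤ B * Real.exp (c * Real.exp (2 * a₁)) * Real.exp (-c * Real.exp (2 * a)) :=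
          mul_le_mul_of_nonneg_left hmono (by positivity)
      _ ≤ max C (B * Real.exp (c * Real.exp (2 * a₁))) * Real.exp (-c * Real.exp (2 * a)) :=
          mul_le_mul_of_nonneg_right (le_max_right _ _) (Real.exp_pos _).le
  · -- large `a`: `a = decayRadius λ` with `λ = e^{a-1} - 1`
    set lam : ℝ := Real.exp (a - 1) - 1 with hlamdef
    have ha2 : 2 ≤ a := le_trans (le_max_left _ _) hlarge.le
    have hexp2 : 2 ≤ Real.exp (a - 1) := by
      have : Real.exp 1 ≤ Real.exp (a - 1) := Real.exp_le_exp.2 (by linarith)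
      linarith [Real.add_one_le_exp (1 : ℝ)]
    have hlam1 : 1 ≤ lam := by rw [hlamdef]; linarith
    have hlam0 : 0 < lam := by linarith
    have hrad : decayRadius lam = a := by
      unfold decayRadius
      rw [hlamdef, sub_add_cancel, Real.log_exp]
      ring
    have hlamge : lam₀ ≤ lam := by
      have h1 : Real.log (lam₀ + 1) + 1 < a := lt_of_le_of_lt (le_max_right _ _) hlarge
      have h2 : Real.exp (Real.log (lam₀ + 1)) < Real.exp (a - 1) := Real.exp_lt_exp.2 (by linarith)
      rw [Real.exp_log (by linarith)] at h2
      rw [hlamdef]; linarith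
    have hhalf : Real.exp (a - 1) / 2 ≤ lam := by rw [hlamdef]; linarith
    have hmain := hC lam hlamge
    rw [hrad] at hmain
    -- `exp(-κ λ²) ≤ exp(-c e^{2a})`
    have hsq : Real.exp (2 * a) / (4 * Real.exp 2) ≤ lam ^ 2 := by
      have h1 : (Real.exp (a - 1) / 2) ^ 2 ≤ lam ^ 2 := pow_le_pow_left₀ (by positivity) hhalf 2
      have h2 : (Real.exp (a - 1) / 2) ^ 2 = Real.exp (2 * a) / (4 * Real.exp 2) := by
        rw [div_pow, ← Real.exp_nat_mul]
        push_cast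
        rw [show (2 : ℝ) * (a - 1) = 2 * a - 2 by ring, Real.exp_sub, div_div,
          show Real.exp 2 * (2 : ℝ) ^ 2 = 4 * Real.exp 2 by ring]
      linarith
    have hexple : Real.exp (-κ * lam ^ 2) ≤ Real.exp (-c * Real.exp (2 * a)) := by
      refine Real.exp_le_exp.2 ?_
      have : c * Real.exp (2 * a) = κ * (Real.exp (2 * a) / (4 * Real.exp 2)) := by
        rw [hc]; field_simp
      rw [neg_mul, neg_mul, this, neg_le_neg_iff]
      exact mul_le_mul_of_nonneg_left hsq hκ0.le
    calc weilGroundEnergy a ≤ C * Real.exp (-κ * lam ^ 2) := hmain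
      _ ≤ C * Real.exp (-c * Real.exp (2 * a)) := mul_le_mul_of_nonneg_left hexple hC0
      _ ≤ max C (B * Real.exp (c * Real.exp (2 * a₁))) * Real.exp (-c * Real.exp (2 * a)) :=
          mul_le_mul_of_nonneg_right (le_max_left _ _) (Real.exp_pos _).le

/-- The same with the constant pulled to the left: `exp(c e^{2a}) ε(a) ≤ C` for `a ≥ 1`. -/
theorem weilGroundEnergy_exp_exp_decay' :
    ∃ c : ℝ, 0 < c ∧ ∃ C : ℝ, ∀ a : ℝ, 1 ≤ a →
      Real.exp (c * Real.exp (2 * a)) * weilGroundEnergy a ≤ C := by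
  obtain ⟨c, hc, C, hC⟩ := weilGroundEnergy_exp_exp_decay
  refine ⟨c, hc, C, fun a ha => ?_⟩
  have := mul_le_mul_of_nonneg_left (hC a ha) (Real.exp_pos (c * Real.exp (2 * a))).le
  rwa [← mul_assoc, mul_comm (Real.exp _) C, mul_assoc, ← Real.exp_add, neg_mul, add_neg_cancel,
    Real.exp_zero, mul_one] at this

end Summit.RiemannHypothesis.RiemannHypothesis.Theorems
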